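import Literature.AnabelianGeometry.EtaleTheta.ClassicalThetaValues
import Mathlib.Analysis.Normed.Ring.Ultra
import Mathlib.Analysis.Normed.Group.Ultra
import Mathlib.Analysis.SpecificLimits.Normed
import HarnessLib

/-!
# [EtTh] §1, Def. 1.9 (ii): the RAW theta series is not of standard type (residue characteristic `≠ 5`)

Mochizuki, *The étale theta function …* [EtTh], Publ. RIMS **45** (2009), §1, Def. 1.9 (ii), PRIMS PDF
p. 29 [cite: MochizukiEtTh2009, Def 1.9 (ii) p.29]: `η̈^{Θ,ℤ}` is *of standard type* iff "the unique value
`∈ O_K^×` of maximal order of some standard set of values … is equal to `±1`", that value being "the value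
at `√−1` of the series representation of `Θ̈` given in Proposition 1.4" for the class in question. For the
Kummer class of `Θ̈` ITSELF this value is `Θ̈(√−1) = √−1 · Σ_{n∈ℤ} q̈^{n(n+1)} = 2√−1·(1 + q̈² + q̈⁶ + …)`
(`ClassicalThetaValues.thetaDdot_sqrt_neg_one`). This file PROVES, in any complete ultrametric normed
field with `‖q̈‖ < 1` and `‖5‖ = 1` (residue characteristic `≠ 5`):

* `norm_tsum_zpow_mul_succ_sub_two_lt` — `‖Σ_{n∈ℤ} q̈^{n(n+1)} − 2‖ < 1`;
* `thetaDdot_sqrt_neg_one_ne_one` — `Θ̈(√−1) ≠ 1` and `Θ̈(√−1) ≠ −1`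
  (if `Θ̈(√−1) = ±1` then `S² = −1` with `S = 2 + T`, `‖T‖ < 1`, so `5 = −(4T + T²)` has norm `< 1`).

Consequence recorded for the cell (L2-lead ruling 2026-08-25T21:02Z): the literal étale theta class
`κ_Θ̈` is not of standard type (for `p ≠ 5`); standard-type statements (Def. 2.7, Cor. 2.8, Cor. 2.19 (iii))
concern the rescaled members `u·κ_Θ̈`, `u = ±Θ̈(√−1)⁻¹ ∈ O_K^×`, of the torsor `O^×_K̈ · η̈^Θ` of
Prop. 1.3. Seat abc-iut-L6-t23 (RQ7 audit). No named facts.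
-/

noncomputable section

namespace Literature.AnabelianGeometry.EtaleTheta

open IsUltrametricDist

variable {𝕜 : Type*} [NormedField 𝕜]

/-- The exponent `n(n+1)` is a natural number `≥ 2` off `n ∈ {0, −1}`. [cite: MochizukiEtTh2009, Prop 1.4 p.21] -/
theorem two_le_mul_succ_of_ne {n : ℤ} (h0 : n ≠ 0) (h1 : n ≠ -1) : (2 : ℤ) ≤ n * (n + 1) := by
  rcases lt_trichotomy n 0 with hn | hn | hn
  · have hn' : n ≤ -2 := by omega
    nlinarith
  · exact absurd hn h0
  · have hn' : 1 ≤ n := by omega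
    nlinarith

/-- `‖q̈^{n(n+1)}‖ ≤ ‖q̈‖²` off `n ∈ {0, −1}` when `‖q̈‖ ≤ 1`. [cite: MochizukiEtTh2009, Prop 1.4 p.21] -/
theorem norm_zpow_mul_succ_le {q2 : 𝕜} (hq : ‖q2‖ ≤ 1) {n : ℤ} (h0 : n ≠ 0) (h1 : n ≠ -1) :
    ‖q2 ^ (n * (n + 1))‖ ≤ ‖q2‖ ^ 2 := by
  have h2 := two_le_mul_succ_of_ne h0 h1
  obtain ⟨m, hm⟩ : ∃ m : ℕ, n * (n + 1) = m := ⟨(n * (n + 1)).toNat, (Int.toNat_of_nonneg (by omega)).symm⟩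
  have hm2 : 2 ≤ m := by exact_mod_cast hm ▸ h2
  rw [hm, zpow_natCast, norm_pow]
  exact pow_le_pow_of_le_one (norm_nonneg _) hq hm2

/-- Summability of `n ↦ q̈^{n(n+1)}` over `ℕ` for `‖q̈‖ < 1` (comparison with the geometric series,
`n(n+1) ≥ n`). [cite: MochizukiEtTh2009, Prop 1.4 (i) p.21] -/
theorem summable_zpow_mul_succ_nat [CompleteSpace 𝕜] {q2 : 𝕜} (hq : ‖q2‖ < 1) :
    Summable fun n : ℕ => q2 ^ ((n : ℤ) * (n + 1)) := by
  refine Summable.of_norm_bounded (summable_geometric_of_lt_one (norm_nonneg _) hq) fun n => ?_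
  have hexp : ((n : ℤ) * (n + 1)) = ((n * (n + 1) : ℕ) : ℤ) := by push_cast; ring
  rw [hexp, zpow_natCast, norm_pow]
  exact pow_le_pow_of_le_one (norm_nonneg _) hq.le (by nlinarith : n ≤ n * (n + 1))

/-- Summability of `n ↦ q̈^{n(n+1)}` over `ℤ` for `‖q̈‖ < 1` (the series is symmetric under
`n ↦ −(n+1)`). [cite: MochizukiEtTh2009, Prop 1.4 (i) p.21] -/
theorem summable_zpow_mul_succ [CompleteSpace 𝕜] {q2 : 𝕜} (hq : ‖q2‖ < 1) :
    Summable fun n : ℤ => q2 ^ (n * (n + 1)) := by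
  refine Summable.of_nat_of_neg_add_one (summable_zpow_mul_succ_nat hq) ?_
  exact (summable_zpow_mul_succ_nat hq).congr fun n => by congr 1; ring

/-- **`Σ_{n∈ℤ} q̈^{n(n+1)} = 2 + (terms of norm < 1)`**: in an ultrametric field with `‖q̈‖ < 1`,
`‖Σ_{n∈ℤ} q̈^{n(n+1)} − 2‖ ≤ ‖q̈‖² < 1` (the two terms `n = 0, −1` contribute `1` each).
[cite: MochizukiEtTh2009, Def 1.9 (ii) p.29] -/
theorem norm_tsum_zpow_mul_succ_sub_two_lt [CompleteSpace 𝕜] [IsUltrametricDist 𝕜] {q2 : 𝕜}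
    (hq : ‖q2‖ < 1) : ‖(∑' n : ℤ, q2 ^ (n * (n + 1))) - 2‖ < 1 := by
  classical
  set f : ℤ → 𝕜 := fun n => q2 ^ (n * (n + 1)) with hf
  have hs : Summable f := summable_zpow_mul_succ hq
  have hf0 : f 0 = 1 := by simp [hf]
  have hf1 : f (-1) = 1 := by simp [hf]
  -- remove the term `n = 0`
  have h0 := hs.tsum_eq_add_tsum_ite 0
  set g : ℤ → 𝕜 := fun n => if n = 0 then 0 else f n with hg
  have hsg : Summable g := by
    have : g = Function.update f 0 0 := by
      funext n; simp only [hg, Function.update_apply]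
    rw [this]; exact hs.update 0 0
  have hg1 : g (-1) = 1 := by simp [hg, hf1]
  -- remove the term `n = -1`
  have h1 := hsg.tsum_eq_add_tsum_ite (-1)
  set T : 𝕜 := ∑' n : ℤ, if n = -1 then 0 else g n with hT
  have hsum : (∑' n : ℤ, f n) - 2 = T := by
    rw [h0, hf0]
    change 1 + ∑' n : ℤ, g n - 2 = T
    rw [h1, hg1]
    ring
  have hTle : ‖T‖ ≤ ‖q2‖ ^ 2 := by
    refine IsUltrametricDist.norm_tsum_le_of_forall_le fun n => ?_
    by_cases hn1 : n = -1
    · simp [hn1]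
    by_cases hn0 : n = 0
    · simp [hg, hn0]
    simp only [hn1, if_false, hg, hn0, hf]
    exact norm_zpow_mul_succ_le hq.le hn0 hn1
  have hq2 : ‖q2‖ ^ 2 < 1 := pow_lt_one₀ (norm_nonneg _) hq two_ne_zero
  change ‖(∑' n : ℤ, f n) - 2‖ < 1
  rw [hsum]
  exact lt_of_le_of_lt hTle hq2

/-- **The raw value `Θ̈(√−1)` is not `±1`** when the residue characteristic is not `5` (`‖5‖ = 1`):
`Θ̈(√−1) = √−1·S` with `S = 2 + T`, `‖T‖ < 1`; if `Θ̈(√−1) = ±1` then `S² = −1`, i.e.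
`5 = −(4T + T²)`, whose norm is `< 1`. Hence the Kummer class of `Θ̈` itself is never of standard type
(Def. 1.9 (ii)) for `p ≠ 5`: "standard type" is a property of the RESCALED classes `u·η̈^Θ`.
[cite: MochizukiEtTh2009, Def 1.9 (ii) p.29] -/
theorem thetaDdot_sqrt_neg_one_ne_one [CompleteSpace 𝕜] [IsUltrametricDist 𝕜] {i q2 : 𝕜}
    (hi : i ^ 2 = -1) (hq : ‖q2‖ < 1) (h5 : ‖(5 : 𝕜)‖ = 1) :
    thetaDdot q2 i ≠ 1 ∧ thetaDdot q2 i ≠ -1 := by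
  have hval := thetaDdot_sqrt_neg_one hi q2
  set S : 𝕜 := ∑' n : ℤ, q2 ^ (n * (n + 1)) with hS
  have hT : ‖S - 2‖ < 1 := norm_tsum_zpow_mul_succ_sub_two_lt hq
  have key : ∀ ε : 𝕜, ε ^ 2 = 1 → thetaDdot q2 i ≠ ε := by
    intro ε hε heq
    rw [hval] at heq
    have h1 : S ^ 2 + 1 = 0 := by
      have h' : (i * S) ^ 2 = ε ^ 2 := by rw [heq]
      rw [mul_pow, hi, hε] at h'
      linear_combination -h'
    set T : 𝕜 := S - 2 with hTdef
    have h2 : (5 : 𝕜) = -(4 * T + T ^ 2) := by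
      have hS' : S = T + 2 := by rw [hTdef]; ring
      rw [hS'] at h1
      linear_combination h1
    have h4le : ‖(4 : 𝕜)‖ ≤ 1 := by
      have := IsUltrametricDist.norm_natCast_le_one 𝕜 4
      simpa using this
    have h4 : ‖(4 : 𝕜) * T‖ < 1 := by
      rw [norm_mul]
      calc ‖(4 : 𝕜)‖ * ‖T‖ ≤ 1 * ‖T‖ := by gcongr
        _ < 1 := by rw [one_mul]; exact hT
    have hT2 : ‖T ^ 2‖ < 1 := by
      rw [norm_pow]; exact pow_lt_one₀ (norm_nonneg _) hT two_ne_zero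
    have h5lt : ‖(5 : 𝕜)‖ < 1 := by
      rw [h2, norm_neg]
      exact lt_of_le_of_lt (IsUltrametricDist.norm_add_le_max _ _) (max_lt h4 hT2)
    exact absurd h5 (ne_of_lt h5lt)
  exact ⟨key 1 (one_pow 2), key (-1) (by norm_num)⟩

/-! ### The exact absolute value `‖Θ̈(√−1)‖ = ‖2‖` (all residue characteristics)

Appended 2026-08-25 (gen 3 of the seat): the author's Comments on [EtTh] (Mar. 2022) (vi) change "the unique
value `∈ O_K^×`" of Def. 1.9 (ii) to "`∈ K^×`"; Def. 2.5 assumes odd residue characteristic. The lemmas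
below record WHY: `Θ̈(√−1) = 2√−1·(1 + q̈² + q̈⁶ + …)` has absolute value `‖2‖` exactly, so it is a unit iff
`p ≠ 2` — and the standard-type representative `Θ̈(√−1)⁻¹ · Θ̈` is an `O_K^×`-multiple of `Θ̈` iff `p ≠ 2`. -/

/-- `Σ_{n∈ℤ} q̈^{n(n+1)} = 2 · Σ_{n∈ℕ} q̈^{n(n+1)}` for `‖q̈‖ < 1`: the symmetry `n ↦ −(n+1)` of the
exponent `n(n+1)`. [cite: MochizukiEtTh2009, Def 1.9 (ii) p.29] -/
theorem tsum_zpow_mul_succ_eq_two_mul [CompleteSpace 𝕜] {q2 : 𝕜} (hq : ‖q2‖ < 1) :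
    ∑' n : ℤ, q2 ^ (n * (n + 1)) = 2 * ∑' n : ℕ, q2 ^ ((n : ℤ) * (n + 1)) := by
  have h1 := summable_zpow_mul_succ_nat hq
  have h2 : Summable fun n : ℕ => q2 ^ ((-((n : ℤ) + 1)) * (-((n : ℤ) + 1) + 1)) :=
    h1.congr fun n => by congr 1; ring
  have key := tsum_of_nat_of_neg_add_one (f := fun n : ℤ => q2 ^ (n * (n + 1))) h1 h2
  rw [key, two_mul]
  congr 1
  exact tsum_congr fun n => by congr 1; ring

/-- `‖Σ_{n∈ℕ} q̈^{n(n+1)}‖ = 1` for `‖q̈‖ < 1` in a complete ultrametric field: the `n = 0` term is `1`,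
every other term has absolute value `≤ ‖q̈‖² < 1`. [cite: MochizukiEtTh2009, Def 1.9 (ii) p.29] -/
theorem norm_tsum_nat_zpow_mul_succ [CompleteSpace 𝕜] [IsUltrametricDist 𝕜] {q2 : 𝕜}
    (hq : ‖q2‖ < 1) : ‖∑' n : ℕ, q2 ^ ((n : ℤ) * (n + 1))‖ = 1 := by
  have hs := summable_zpow_mul_succ_nat hq
  rw [hs.tsum_eq_zero_add]
  have h0 : q2 ^ (((0 : ℕ) : ℤ) * ((0 : ℕ) + 1)) = (1 : 𝕜) := by simp
  rw [h0]
  have hT : ‖∑' n : ℕ, q2 ^ (((n + 1 : ℕ) : ℤ) * ((n + 1 : ℕ) + 1))‖ < 1 := by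
    refine lt_of_le_of_lt (IsUltrametricDist.norm_tsum_le_of_forall_le (C := ‖q2‖ ^ 2) fun n => ?_)
      (pow_lt_one₀ (norm_nonneg _) hq two_ne_zero)
    have hexp : (((n + 1 : ℕ) : ℤ) * ((n + 1 : ℕ) + 1)) = ((n : ℤ) + 1) * (((n : ℤ) + 1) + 1) := by
      push_cast; ring
    rw [hexp]
    exact norm_zpow_mul_succ_le hq.le (by omega) (by omega)
  have hne : ‖(1 : 𝕜)‖ ≠ ‖∑' n : ℕ, q2 ^ (((n + 1 : ℕ) : ℤ) * ((n + 1 : ℕ) + 1))‖ := by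
    rw [norm_one]; exact (ne_of_lt hT).symm
  rw [IsUltrametricDist.norm_add_eq_max_of_norm_ne_norm hne, norm_one]
  exact max_eq_left hT.le

/-- **`‖Θ̈(√−1)‖ = ‖2‖`** (any complete ultrametric field, `‖q̈‖ < 1`, `i² = −1`): so `Θ̈(√−1)` is a unit
exactly in odd residue characteristic — the reason for the author's correction (vi) to Def. 1.9 (ii)
("`∈ K^×`", not "`∈ O_K^×`") and for the standing hypothesis "odd residue characteristic" of Def. 2.5;
in particular the standard-type representative `Θ̈(√−1)⁻¹·Θ̈` (Thm. 5.7) lies in the `O_K^×`-torsor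
`O_K^× · κ_Θ̈` of Prop. 1.3 iff `p ≠ 2`. [cite: MochizukiEtTh2009, Def 1.9 (ii) p.29; Comments (Mar 2022) (vi)] -/
theorem norm_thetaDdot_sqrt_neg_one [CompleteSpace 𝕜] [IsUltrametricDist 𝕜] {i q2 : 𝕜}
    (hi : i ^ 2 = -1) (hq : ‖q2‖ < 1) : ‖thetaDdot q2 i‖ = ‖(2 : 𝕜)‖ := by
  have hival : ‖i‖ = 1 := by
    have h : ‖i‖ ^ 2 = 1 := by rw [← norm_pow, hi, norm_neg, norm_one]
    nlinarith [norm_nonneg i, h]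
  rw [thetaDdot_sqrt_neg_one hi q2, tsum_zpow_mul_succ_eq_two_mul hq, norm_mul, norm_mul, hival,
    norm_tsum_nat_zpow_mul_succ hq, one_mul, mul_one]

/-- **`Θ̈(√−1)` is a unit iff `2` is**: `‖Θ̈(√−1)‖ = 1 ↔ ‖2‖ = 1` (odd residue characteristic).
[cite: MochizukiEtTh2009, Def 1.9 (ii) p.29; Comments (Mar 2022) (vi)] -/
theorem norm_thetaDdot_sqrt_neg_one_eq_one_iff [CompleteSpace 𝕜] [IsUltrametricDist 𝕜] {i q2 : 𝕜}
    (hi : i ^ 2 = -1) (hq : ‖q2‖ < 1) : ‖thetaDdot q2 i‖ = 1 ↔ ‖(2 : 𝕜)‖ = 1 := by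
  rw [norm_thetaDdot_sqrt_neg_one hi hq]

end Literature.AnabelianGeometry.EtaleTheta

end
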